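import Literature.NumberTheory.PAdicHodge.TateTameStructure
import Literature.NumberTheory.PAdicHodge.TateAlmostEtaleRadicalPackage
import Literature.NumberTheory.PAdicHodge.TateAlmostEtalePackageStep
import Literature.NumberTheory.PAdicHodge.TateAlmostEtalePTower
import HarnessLib

/-!
# Tate's almost étale lemma (TS1), last step: prime-to-`p` extensions of `K_∞` are almost-perfectoid
# (the tame package (C), Tate 1967 §3.2 Prop. 9 / Berger–Colmez Prop. 4.1.1)

Notation of the tree's `PAdicHodge` files (`K₀ = PadicBase F p hp ≅ ℚ_p`, `F̄ = NormedAlgClosure F`,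
`K_∞ = TateTrace.Kinf hp = K₀(μ_{p^∞})`, `q = ‖p‖`). The ALMOST-PERFECTOID PACKAGE `pkg_s(M)` of a
subfield `M ⊆ F̄` is: (Γ) `‖M^×‖` is `p`-divisible, and (U_s) every `u ∈ M`, `‖u‖ ≤ 1`, is `w^p + O(q^s)`
with `w ∈ M`. The tree proves `pkg_1(K_∞)` (`CyclotomicTowerPthPowers`) and that the package ascends
along root-of-unity steps (`adjoin_rootOfUnity_package`), prime radical steps `ℓ ≠ p`
(`adjoin_primeRadical_package`) and Kummer `p`-steps (`TateAlmostEtalePackageStep`); the tame structure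
theorem (`TateTameStructure.eq_adjoin_rootOfUnity_radical`) says every finite `T ⊇ K_∞` of degree
prime to `p` is `K_∞(ζ, α)` with `ζ^N = 1`, `p ∤ N`, `α^e ∈ K_∞(ζ)^×`. Here:

* `TateAlmostEtale.adjoin_radicalTower_package` : **the package ascends along ANY radical step** — for
  `K_∞ ⊆ M` with `pkg_s(M)` and `α^e = c ∈ M^×` (`e ≥ 1` arbitrary), `pkg_{s'}(M(α))` for some `s' > 0`
  (induction on `e` through a prime factor `ℓ`: `ℓ ≠ p` radical step, or a Kummer `p`-step when
  `X^p - c'` is irreducible, or a trivial step when it is not — `μ_p ⊂ K_∞ ⊆ M`);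
* `TateAlmostEtale.tamePackage` : **(C) — every finite extension of `K_∞` inside `F̄` of degree prime
  to `p` has the package `pkg_s` for some `s > 0`.** This is the last hypothesis of
  `tate1967_TS1_of_tame` (`TateSenConditionKummerRoute`); the Tate–Sen axiom (TS1) follows
  unconditionally (`TateSenConditionHolds`).

No `sorry`, no definitions. References: J. Tate, *p-divisible groups* (1967) §3.2 Prop. 9 [Tate1967];
L. Berger, P. Colmez, Astérisque 319 (2008) Prop. 4.1.1 [BergerColmez2008]; P. Scholze,
*Perfectoid spaces* (2012) Lemma 3.2, Thm. 3.7 [Scholze2012]; S. Lang, ANT II §5 Prop. 12 [LangANT1994].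
-/

noncomputable section

open Polynomial IntermediateField Module ValuativeRel Field

namespace Literature.NumberTheory.PAdicHodge

namespace TateAlmostEtale

open Literature.NumberTheory.GaloisRepresentations
open Literature.NumberTheory.GaloisRepresentations.IsNonarchimedeanLocalField
open CyclotomicTower

variable {F : Type} [Field F] [ValuativeRel F] [TopologicalSpace F] [IsNonarchimedeanLocalField F]
  [CharZero F] {p : ℕ} [Fact p.Prime] (hp : valuation F p < 1)

/-! ### §1 Membership bookkeeping for simple adjunctions -/

section Membership

variable (M : IntermediateField (PadicBase F p hp) (NormedAlgClosure F))

/-- `M(β) = M` elementwise when `β ∈ M`. [folklore] -/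
private theorem mem_adjoin_simple_iff_of_mem {β : NormedAlgClosure F} (hβ : β ∈ M) (x : NormedAlgClosure F) :
    x ∈ (↥M)⟮β⟯ ↔ x ∈ M := by
  have hbot : (↥M)⟮β⟯ = ⊥ := IntermediateField.adjoin_simple_eq_bot_iff.mpr
    (IntermediateField.mem_bot.mpr ⟨⟨β, hβ⟩, rfl⟩)
  rw [hbot, IntermediateField.mem_bot]
  constructor
  · rintro ⟨y, rfl⟩; exact y.2
  · intro hx; exact ⟨⟨x, hx⟩, rfl⟩

/-- `M₁(α) = M(α)` elementwise when `M ⊆ M₁ ⊆ M(α)`. [folklore] -/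
private theorem mem_adjoin_simple_iff_of_le (M₁ : IntermediateField (PadicBase F p hp) (NormedAlgClosure F))
    (hMM₁ : M ≤ M₁) {α : NormedAlgClosure F}
    (hM₁ : M₁ ≤ ((↥M)⟮α⟯).restrictScalars (PadicBase F p hp)) (x : NormedAlgClosure F) :
    x ∈ (↥M₁)⟮α⟯ ↔ x ∈ (↥M)⟮α⟯ := by
  rw [← IntermediateField.mem_restrictScalars (PadicBase F p hp) (E := (↥M₁)⟮α⟯),
    ← IntermediateField.mem_restrictScalars (PadicBase F p hp) (E := (↥M)⟮α⟯),
    IntermediateField.restrictScalars_adjoin, IntermediateField.restrictScalars_adjoin]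
  constructor
  · intro hx
    refine (IntermediateField.adjoin_le_iff.mpr ?_) hx
    intro y hy
    rcases hy with hy | hy
    · have := hM₁ hy
      rwa [IntermediateField.mem_restrictScalars, ← IntermediateField.mem_restrictScalars (PadicBase F p hp),
        IntermediateField.restrictScalars_adjoin] at this
    · rw [Set.mem_singleton_iff] at hy; subst hy
      exact IntermediateField.subset_adjoin _ _ (Set.mem_union_right _ rfl)
  · intro hx
    refine (IntermediateField.adjoin_le_iff.mpr ?_) hx
    intro y hy
    rcases hy with hy | hy
    · exact IntermediateField.subset_adjoin _ _ (Set.mem_union_left _ (hMM₁ hy))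
    · rw [Set.mem_singleton_iff] at hy; subst hy
      exact IntermediateField.subset_adjoin _ _ (Set.mem_union_right _ rfl)

end Membership

/-! ### §2 The package ascends along arbitrary radical steps -/

section Radical

set_option maxHeartbeats 1600000 in
/-- **The almost-perfectoid package ascends along any radical step over `K_∞`.** For `K_∞ ⊆ M ⊆ F̄`
with `pkg_s(M)` (`s > 0`), `e ≥ 1` and `α ∈ F̄` with `α^e = c ∈ M^×`: `pkg_{s'}(M(α))` for some
`s' > 0`. Induction on `e` through a prime factor `ℓ ∣ e`, `β = α^{e/ℓ}`: the step `M ⊆ M(β)` is a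
prime radical step `ℓ ≠ p` (`adjoin_primeRadical_package`), or a Kummer `p`-step with `X^p - c`
irreducible (`adjoin_exists_norm_pow_eq`, `adjoin_exists_norm_sub_pow_le`), or trivial (`c = b^p`,
`b ∈ M`, and `β = ζ b` with `ζ ∈ μ_p ⊂ K_∞ ⊆ M`); then `M(β) ⊆ M(α) = M(β)(α)` with `α^{e/ℓ} = β`.
[cite: Tate1967, §3.2 Prop. 9] [cite: Scholze2012, Lemma 3.2] [cite: BergerColmez2008, Prop. 4.1.1] -/
theorem adjoin_radicalTower_package (e : ℕ) :
    ∀ (M : IntermediateField (PadicBase F p hp) (NormedAlgClosure F)), TateTrace.Kinf hp ≤ M → 0 < e →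
    ∀ {s : ℝ}, 0 < s →
    (∀ x ∈ M, x ≠ 0 → ∃ c ∈ M, ‖c‖ ^ p = ‖x‖) →
    (∀ u ∈ M, ‖u‖ ≤ 1 → ∃ w ∈ M, ‖u - w ^ p‖ ≤ ‖(p : NormedAlgClosure F)‖ ^ s) →
    ∀ {α c : NormedAlgClosure F}, c ∈ M → c ≠ 0 → α ^ e = c →
    ∃ s' : ℝ, 0 < s' ∧ (∀ x ∈ (↥M)⟮α⟯, x ≠ 0 → ∃ c ∈ (↥M)⟮α⟯, ‖c‖ ^ p = ‖x‖) ∧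
      (∀ u ∈ (↥M)⟮α⟯, ‖u‖ ≤ 1 → ∃ w ∈ (↥M)⟮α⟯, ‖u - w ^ p‖ ≤ ‖(p : NormedAlgClosure F)‖ ^ s') := by
  classical
  have hprime : p.Prime := Fact.out
  induction e using Nat.strong_induction_on with
  | _ e ih =>
  intro M hKM he s hs hΓ hU α c hcM hc0 hα
  set K₀ := PadicBase F p hp
  have hα0 : α ≠ 0 := by intro h; rw [h, zero_pow he.ne'] at hα; exact hc0 hα.symm
  rcases Nat.lt_or_ge 1 e with h1e | he1
  · -- `e ≥ 2`: a prime factor `ℓ`, `e = ℓ e'`, `β = α^{e'}`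
    set ℓ : ℕ := e.minFac with hℓ
    have hℓprime : ℓ.Prime := Nat.minFac_prime (by omega)
    obtain ⟨e', he'⟩ : ℓ ∣ e := Nat.minFac_dvd e
    have he'pos : 0 < e' := by
      rcases Nat.eq_zero_or_pos e' with h | h
      · rw [h, mul_zero] at he'; omega
      · exact h
    have he'lt : e' < e := by
      rw [he']; exact lt_mul_left he'pos hℓprime.one_lt
    set β : NormedAlgClosure F := α ^ e' with hβ
    have hβℓ : β ^ ℓ = c := by rw [hβ, ← pow_mul, mul_comm, ← he', hα]
    have hβ0 : β ≠ 0 := pow_ne_zero _ hα0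
    -- Step 1: the package of `M(β)`
    have step : ∃ s₁ : ℝ, 0 < s₁ ∧ (∀ x ∈ (↥M)⟮β⟯, x ≠ 0 → ∃ c ∈ (↥M)⟮β⟯, ‖c‖ ^ p = ‖x‖) ∧
        (∀ u ∈ (↥M)⟮β⟯, ‖u‖ ≤ 1 → ∃ w ∈ (↥M)⟮β⟯, ‖u - w ^ p‖ ≤ ‖(p : NormedAlgClosure F)‖ ^ s₁) := by
      by_cases hℓp : ℓ = p
      · -- Kummer `p`-step
        set cM : M := ⟨c, hcM⟩ with hcM'
        have hβp : β ^ p = (cM : NormedAlgClosure F) := by have h := hβℓ; rwa [hℓp] at h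
        by_cases hirr : Irreducible (Polynomial.X ^ p - C cM)
        · refine ⟨min s 1 / 2, by positivity, fun x hx hx0 => adjoin_exists_norm_pow_eq hp M hΓ hirr hβp hx hx0,
            fun u hu hu1 => adjoin_exists_norm_sub_pow_le hp M hs hΓ hU hirr hβp (by positivity) ?_ hu hu1⟩
          have : 0 < min s 1 := lt_min hs one_pos
          linarith
        · -- `c = b^p` with `b ∈ M`: `β = (β/b) b`, `β/b ∈ μ_p ⊂ K_∞ ⊆ M`
          rw [X_pow_sub_C_irreducible_iff_of_prime hprime] at hirr
          push Not at hirr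
          obtain ⟨b, hb⟩ := hirr
          have hb0 : (b : NormedAlgClosure F) ≠ 0 := by
            intro h
            have : (b : M) = 0 := Subtype.ext h
            rw [this, zero_pow hprime.ne_zero] at hb
            exact hc0 (by rw [hcM'] at hb; exact (congrArg Subtype.val hb).symm)
          have hζ : (β * (b : NormedAlgClosure F)⁻¹) ^ p ^ 1 = 1 := by
            rw [pow_one, mul_pow, inv_pow, hβp, ← hb]
            push_cast
            exact mul_inv_cancel₀ (pow_ne_zero _ hb0)
          have hζM : β * (b : NormedAlgClosure F)⁻¹ ∈ M :=
            hKM (TateTrace.K_le_Kinf hp 1 (mem_K_of_pow_eq_one hp hζ))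
          have hβM : β ∈ M := by
            have : β = β * (b : NormedAlgClosure F)⁻¹ * b := by
              rw [mul_assoc, inv_mul_cancel₀ hb0, mul_one]
            rw [this]; exact mul_mem hζM b.2
          refine ⟨s, hs, fun x hx hx0 => ?_, fun u hu hu1 => ?_⟩
          · rw [mem_adjoin_simple_iff_of_mem hp M hβM] at hx
            obtain ⟨c', hc'M, hc'⟩ := hΓ x hx hx0
            exact ⟨c', (mem_adjoin_simple_iff_of_mem hp M hβM c').mpr hc'M, hc'⟩
          · rw [mem_adjoin_simple_iff_of_mem hp M hβM] at hu
            obtain ⟨w, hwM, hw⟩ := hU u hu hu1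
            exact ⟨w, (mem_adjoin_simple_iff_of_mem hp M hβM w).mpr hwM, hw⟩
      · -- prime radical step `ℓ ≠ p`
        obtain ⟨hΓ₁, hU₁⟩ := adjoin_primeRadical_package hp M hKM hℓprime hℓp hs hΓ hU hcM hc0 hβℓ
        exact ⟨min s 1 / 2, by positivity, hΓ₁, hU₁⟩
    obtain ⟨s₁, hs₁, hΓ₁, hU₁⟩ := step
    -- Step 2: induction over `M₁ = M(β)` with `α^{e'} = β`
    set M₁ : IntermediateField K₀ (NormedAlgClosure F) := ((↥M)⟮β⟯).restrictScalars K₀ with hM₁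
    have hmemM₁ : ∀ x, x ∈ M₁ ↔ x ∈ (↥M)⟮β⟯ := fun x => IntermediateField.mem_restrictScalars K₀
    have hMM₁ : M ≤ M₁ := fun x hx => (hmemM₁ x).mpr (((↥M)⟮β⟯).algebraMap_mem ⟨x, hx⟩)
    have hKM₁ : TateTrace.Kinf hp ≤ M₁ := hKM.trans hMM₁
    have hβM₁ : β ∈ M₁ := (hmemM₁ β).mpr (IntermediateField.mem_adjoin_simple_self _ β)
    obtain ⟨s₂, hs₂, hΓ₂, hU₂⟩ := ih e' he'lt M₁ hKM₁ he'pos hs₁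
      (fun x hx hx0 => by
        obtain ⟨c', hc', h⟩ := hΓ₁ x ((hmemM₁ x).mp hx) hx0
        exact ⟨c', (hmemM₁ c').mpr hc', h⟩)
      (fun u hu hu1 => by
        obtain ⟨w, hw, h⟩ := hU₁ u ((hmemM₁ u).mp hu) hu1
        exact ⟨w, (hmemM₁ w).mpr hw, h⟩)
      hβM₁ hβ0 hβ.symm
    -- Step 3: `M₁(α) = M(α)`
    have hM₁le : M₁ ≤ ((↥M)⟮α⟯).restrictScalars K₀ := by
      intro x hx
      rw [IntermediateField.mem_restrictScalars]
      have hle : (↥M)⟮β⟯ ≤ (↥M)⟮α⟯ := by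
        rw [IntermediateField.adjoin_simple_le_iff, hβ]
        exact pow_mem (IntermediateField.mem_adjoin_simple_self _ α) e'
      exact hle ((hmemM₁ x).mp hx)
    have hmem : ∀ x, x ∈ (↥M₁)⟮α⟯ ↔ x ∈ (↥M)⟮α⟯ :=
      mem_adjoin_simple_iff_of_le hp M M₁ hMM₁ hM₁le
    refine ⟨s₂, hs₂, fun x hx hx0 => ?_, fun u hu hu1 => ?_⟩
    · obtain ⟨c', hc', h⟩ := hΓ₂ x ((hmem x).mpr hx) hx0
      exact ⟨c', (hmem c').mp hc', h⟩
    · obtain ⟨w, hw, h⟩ := hU₂ u ((hmem u).mpr hu) hu1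
      exact ⟨w, (hmem w).mp hw, h⟩
  · -- `e = 1`: `α = c ∈ M`
    have he1' : e = 1 := le_antisymm he1 he
    rw [he1', pow_one] at hα
    have hαM : α ∈ M := hα ▸ hcM
    refine ⟨s, hs, fun x hx hx0 => ?_, fun u hu hu1 => ?_⟩
    · rw [mem_adjoin_simple_iff_of_mem hp M hαM] at hx
      obtain ⟨c', hc'M, hc'⟩ := hΓ x hx hx0
      exact ⟨c', (mem_adjoin_simple_iff_of_mem hp M hαM c').mpr hc'M, hc'⟩
    · rw [mem_adjoin_simple_iff_of_mem hp M hαM] at hu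
      obtain ⟨w, hwM, hw⟩ := hU u hu hu1
      exact ⟨w, (mem_adjoin_simple_iff_of_mem hp M hαM w).mpr hwM, hw⟩

end Radical

/-! ### §3 (C): prime-to-`p` extensions of `K_∞` are almost-perfectoid -/

section TamePackage

set_option maxHeartbeats 800000 in
/-- **(C) — the tame package.** Every finite extension `K_∞ ⊆ T ⊆ F̄` of degree prime to `p` has
the almost-perfectoid package: (Γ) `‖T^×‖` is `p`-divisible and (U_s) every integer of `T` is a `p`-th
power modulo `p^s`, for some `s > 0`. Proof: `T = K_∞(ζ, α)` by the tame structure theorem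
(`eq_adjoin_rootOfUnity_radical`); `pkg_1(K_∞)` (`Kinf_exists_norm_pow_eq`,
`Kinf_exists_norm_sub_pow_le`) ascends to `K_∞(ζ)` (`adjoin_rootOfUnity_package`) and then to
`K_∞(ζ)(α)` (`adjoin_radicalTower_package`). This discharges the last hypothesis of the tree's Kummer-route
reduction `tate1967_TS1_of_tame` of Tate's almost étale lemma.
[cite: Tate1967, §3.2 Prop. 9] [cite: BergerColmez2008, Prop. 4.1.1] [cite: Scholze2012, Thm. 3.7] -/
theorem tamePackage (T : IntermediateField (TateTrace.Kinf hp) (NormedAlgClosure F))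
    (hfin : FiniteDimensional (TateTrace.Kinf hp) T) (hd : ¬ p ∣ finrank (TateTrace.Kinf hp) T) :
    ∃ s : ℝ, 0 < s ∧ (∀ x ∈ T, x ≠ 0 → ∃ c ∈ T, ‖c‖ ^ p = ‖x‖) ∧
      (∀ u ∈ T, ‖u‖ ≤ 1 → ∃ w ∈ T, ‖u - w ^ p‖ ≤ ‖(p : NormedAlgClosure F)‖ ^ s) := by
  classical
  have hprime : p.Prime := Fact.out
  haveI := hfin
  set K₀ := PadicBase F p hp
  obtain ⟨N, e, ζ, α, hN0, hpN, he0, hpe, hζN, hα0, hαe, hT⟩ := eq_adjoin_rootOfUnity_radical hp T hd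
  -- `pkg_1(K_∞)`
  have hΓ₀ : ∀ x ∈ TateTrace.Kinf hp, x ≠ 0 → ∃ c ∈ TateTrace.Kinf hp, ‖c‖ ^ p = ‖x‖ :=
    fun x hx hx0 => Kinf_exists_norm_pow_eq hp hx hx0
  have hU₀ : ∀ u ∈ TateTrace.Kinf hp, ‖u‖ ≤ 1 → ∃ w ∈ TateTrace.Kinf hp,
      ‖u - w ^ p‖ ≤ ‖(p : NormedAlgClosure F)‖ ^ (1 : ℝ) := by
    intro u hu hu1
    obtain ⟨w, hw, h⟩ := Kinf_exists_norm_sub_pow_le hp hu hu1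
    exact ⟨w, hw, by rwa [Real.rpow_one]⟩
  -- `pkg_1(K_∞(ζ))`
  obtain ⟨hΓ₁, hU₁⟩ := adjoin_rootOfUnity_package hp (TateTrace.Kinf hp) hpN hN0.ne' hζN one_pos hΓ₀ hU₀
  rw [min_self] at hU₁
  set M₁ : IntermediateField K₀ (NormedAlgClosure F) := ((↥(TateTrace.Kinf hp))⟮ζ⟯).restrictScalars K₀
    with hM₁
  have hmemM₁ : ∀ x, x ∈ M₁ ↔ x ∈ (↥(TateTrace.Kinf hp))⟮ζ⟯ := fun x =>
    IntermediateField.mem_restrictScalars K₀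
  have hKM₁ : TateTrace.Kinf hp ≤ M₁ := fun x hx =>
    (hmemM₁ x).mpr (((↥(TateTrace.Kinf hp))⟮ζ⟯).algebraMap_mem ⟨x, hx⟩)
  have hcM₁ : α ^ e ∈ M₁ := (hmemM₁ _).mpr hαe
  -- `pkg_{s'}(K_∞(ζ)(α))`
  obtain ⟨s', hs', hΓ₂, hU₂⟩ := adjoin_radicalTower_package hp e M₁ hKM₁ he0 one_pos
    (fun x hx hx0 => by
      obtain ⟨c', hc', h⟩ := hΓ₁ x ((hmemM₁ x).mp hx) hx0
      exact ⟨c', (hmemM₁ c').mpr hc', h⟩)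
    (fun u hu hu1 => by
      obtain ⟨w, hw, h⟩ := hU₁ u ((hmemM₁ u).mp hu) hu1
      exact ⟨w, (hmemM₁ w).mpr hw, h⟩)
    hcM₁ (pow_ne_zero _ hα0) rfl
  -- `T = K_∞(ζ, α) = K_∞(ζ)(α)` elementwise
  have hmemT : ∀ x, x ∈ T ↔ x ∈ (↥M₁)⟮α⟯ := by
    intro x
    rw [hT, ← IntermediateField.adjoin_simple_adjoin_simple, IntermediateField.mem_restrictScalars,
      ← IntermediateField.mem_toSubfield, ← IntermediateField.mem_toSubfield (s := (↥M₁)⟮α⟯),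
      IntermediateField.adjoin_toSubfield, IntermediateField.adjoin_toSubfield]
    have hr : Set.range (algebraMap (↥(↥(TateTrace.Kinf hp))⟮ζ⟯) (NormedAlgClosure F)) =
        Set.range (algebraMap (↥M₁) (NormedAlgClosure F)) := by
      ext y
      simp only [Set.mem_range]
      constructor
      · rintro ⟨z, rfl⟩; exact ⟨⟨(z : NormedAlgClosure F), (hmemM₁ z).mpr z.2⟩, rfl⟩
      · rintro ⟨z, rfl⟩; exact ⟨⟨(z : NormedAlgClosure F), (hmemM₁ z).mp z.2⟩, rfl⟩
    rw [hr]
  refine ⟨s', hs', fun x hx hx0 => ?_, fun u hu hu1 => ?_⟩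
  · obtain ⟨c', hc', h⟩ := hΓ₂ x ((hmemT x).mp hx) hx0
    exact ⟨c', (hmemT c').mpr hc', h⟩
  · obtain ⟨w, hw, h⟩ := hU₂ u ((hmemT u).mp hu) hu1
    exact ⟨w, (hmemT w).mpr hw, h⟩

end TamePackage

end TateAlmostEtale

end Literature.NumberTheory.PAdicHodge

end
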